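import Summits.Ventures.LatticeQCDFlow.Exactness.IMHCommonRandomNumbersSplit
import Summits.Ventures.LatticeQCDFlow.Exactness.IMHColdStartPathMixture
import Summits.Ventures.LatticeQCDFlow.Scoring.ChainPathLaw
import HarnessLib

/-!
# Common random numbers on path space: each coordinate of the coupled simulation IS a run of the sampler, the
# diagonal start is ONE run recorded twice, and after `b` shared updates the pair stream is
# `(1 − r^b)·(one equilibrium run, twice) + r^b·(residual)` — two runs fed the same random numbers COINCIDE FOREVER
# after the burn-in except with probability `r^b`

HONEST FRAMING: exact (Metropolis-corrected) sampling algorithms for lattice gauge theory;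
figures of merit are autocorrelation/cost numbers at stated couplings and volumes; no
continuum-physics claim.

Venture `LatticeQCDFlow` (cell pub-lqcd), topic `Exactness`; FANOUT row 30 (lean-1, GEN-36).  NEW WORK of the
cell, general state space.  `Exactness/IMHCommonRandomNumbers{,Split}` (this generation) built the common-random-
numbers pair kernel `K̂` of flow-MCMC `K = indepMH q w` (`A = 1/w(x₀)`, `r = 1 − A`) and its exact split
`μ̂₀K̂ⁿ = (1 − rⁿ)·π̂ + rⁿ·μ̂₀R̂ⁿ`, `π̂` the diagonal lift of the target.  Here the coupled SIMULATION — Mathlib's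
`Kernel.trajMeasure` of `K̂` on `ℕ → Ω × Ω`, written `P̂_{μ̂₀}` — is identified with what a practitioner records, using
the functoriality ∕ Markov-property theorems of `Scoring/ChainPathLaw` (row 8) and GEN-33's bookkeeping
(`Exactness/IMHColdStartPathMixture.chain_add_smul`, `chain_map_shift_eq`):

* §1 **`crn_chain_map_fst`**, **`crn_chain_map_snd`** — EACH COORDINATE OF THE COUPLED SIMULATION IS A RUN OF THE
  SAMPLER: the image of `P̂_{μ̂₀}` under `ẑ ↦ (n ↦ (ẑ n)₁)` is the flow-MCMC path law `P_{μ̂₀∘fst⁻¹}` (and `snd`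
  likewise) — sharing random numbers with another run changes nothing about one's own run;
  **`crn_chain_diagLift`** — THE DIAGONAL START IS ONE RUN RECORDED TWICE: `P̂_{μ∘diag⁻¹} = P_μ ∘ (x ↦ (x, x))⁻¹`.
* §2 **`crn_chain_shift_anyCoupling`** — FOR EVERY INITIAL COUPLING `μ̂₀` and every `b` (`w(x₀) > 1`):
  `P̂_{μ̂₀} ∘ θ_b⁻¹ = (1 − r^b)·(P_π ∘ (x ↦ (x, x))⁻¹) + r^b·P̂_{μ̂₀R̂^b}` EXACTLY — after `b` shared updates the pair
  of recorded streams IS, with probability `1 − r^b`, ONE equilibrium run recorded twice;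
  **`crn_chain_shift_anyCoupling_exists`** — the `R̂`-free form for `w(x₀) ≥ 1`.
* §3 consequences for every measurable path statistic `F` (acceptance fractions, histograms, window averages,
  autocovariance ∕ `τ_int` estimators, error bars) and every initial coupling:
  **`crn_chain_statistic_eq_ge`** — `P(F(X_{b+·}) = F(X′_{b+·})) ≥ 1 − r^b`: THE TWO RECORDED STREAMS RETURN
  IDENTICAL RESULTS except with probability `r^b` (diagonal-free, any measurable space);
  **`crn_chain_coincide_forever_ge`** — under `MeasurableEq Ω`: `P(X_{b+n} = X′_{b+n} for all n) ≥ 1 − r^b` —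
  THE RUNS COINCIDE FOREVER AFTER THE BURN-IN; **`crn_chain_coincide_forever_ge_of_log_le`** — `log(1/δ) ≤ b·A`
  shared updates suffice for probability `≥ 1 − δ`; **`crn_chain_integral_abs_sub_le`** — for `a ≤ F ≤ c`:
  `E|F(X_{b+·}) − F(X′_{b+·})| ≤ r^b·(c − a)` — the common-random-numbers difference of EVERY bounded statistic is
  at most `r^b ×` its range in mean (GEN-35 `IMHTwoStarts`: the difference of EXPECTATIONS obeys the same bound for
  arbitrary joint laws; under shared random numbers the statistics themselves agree).
Reading (gauge files `Scaling/AutoregressiveGauge…CommonRandomNumbers`): two exact gauge samplers fed the same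
autoregressive proposals and uniforms from any two initial configurations produce, after `b` discarded
configurations, literally the same stream except with probability `(1 − A)^b`; replica comparisons under shared
random numbers test nothing but the burn-in.
NOT CLAIMED: the law of the merging time beyond its tail `r^b` (exact for a modal start, not proved here); anything
for runs with different targets or different proposals; independence of the merged stream from the merging time.
No `sorry`, no new definitions, nothing cited as a fact.
-/

noncomputable section

namespace Summit.Ventures.LatticeQCDFlow.Exactness

open MeasureTheory ProbabilityTheory Function Set
open scoped ENNReal unitInterval
open Summit.Ventures.LatticeQCDFlow.Scoring Literature.Probability.MarkovChains

variable {Ω : Type*} [MeasurableSpace Ω] {q : Measure Ω} [IsProbabilityMeasure q] {w : Ω → ℝ}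

/-! ## §1 The coordinates of the coupled simulation and the diagonal start -/

/-- **THE FIRST COORDINATE OF THE COUPLED SIMULATION IS A RUN OF THE SAMPLER**: the image of the pair path law
`P̂_{μ̂₀}` under `ẑ ↦ (n ↦ (ẑ n)₁)` is the flow-MCMC path law from `μ̂₀∘fst⁻¹`. [ours] -/
theorem crn_chain_map_fst [Fact (Measurable w)] (hw0 : ∀ y, 0 < w y) (Khat : Kernel (Ω × Ω) (Ω × Ω))
    [IsMarkovKernel Khat]
    (hK : ∀ z : Ω × Ω, Khat z = (q.prod (volume : Measure unitInterval)).map (fun p : Ω × unitInterval =>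
      ((if (p.2 : ℝ) * w z.1 ≤ w p.1 then p.1 else z.1), (if (p.2 : ℝ) * w z.2 ≤ w p.1 then p.1 else z.2))))
    (μ₀ : Measure (Ω × Ω)) [IsProbabilityMeasure μ₀] :
    (Kernel.trajMeasure (X := fun _ : ℕ => Ω × Ω) μ₀
        (fun n : ℕ => Khat.comap (fun h : (i : ↥(Finset.Iic n)) → Ω × Ω => h ⟨n, Finset.mem_Iic.2 le_rfl⟩)
          (measurable_pi_apply _))).map (fun (z : ℕ → Ω × Ω) (n : ℕ) => (z n).1) =
      Kernel.trajMeasure (X := fun _ : ℕ => Ω) (μ₀.map Prod.fst)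
        (fun n : ℕ => (indepMH q w).comap (fun h : (i : ↥(Finset.Iic n)) → Ω => h ⟨n, Finset.mem_Iic.2 le_rfl⟩)
          (measurable_pi_apply _)) :=
  chain_map_of_intertwining (indepMH q w) Khat μ₀ measurable_fst (crnPair_map_fst Fact.out hw0 Khat hK)

/-- **THE SECOND COORDINATE OF THE COUPLED SIMULATION IS A RUN OF THE SAMPLER** (from `μ̂₀∘snd⁻¹`). [ours] -/
theorem crn_chain_map_snd [Fact (Measurable w)] (hw0 : ∀ y, 0 < w y) (Khat : Kernel (Ω × Ω) (Ω × Ω))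
    [IsMarkovKernel Khat]
    (hK : ∀ z : Ω × Ω, Khat z = (q.prod (volume : Measure unitInterval)).map (fun p : Ω × unitInterval =>
      ((if (p.2 : ℝ) * w z.1 ≤ w p.1 then p.1 else z.1), (if (p.2 : ℝ) * w z.2 ≤ w p.1 then p.1 else z.2))))
    (μ₀ : Measure (Ω × Ω)) [IsProbabilityMeasure μ₀] :
    (Kernel.trajMeasure (X := fun _ : ℕ => Ω × Ω) μ₀
        (fun n : ℕ => Khat.comap (fun h : (i : ↥(Finset.Iic n)) → Ω × Ω => h ⟨n, Finset.mem_Iic.2 le_rfl⟩)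
          (measurable_pi_apply _))).map (fun (z : ℕ → Ω × Ω) (n : ℕ) => (z n).2) =
      Kernel.trajMeasure (X := fun _ : ℕ => Ω) (μ₀.map Prod.snd)
        (fun n : ℕ => (indepMH q w).comap (fun h : (i : ↥(Finset.Iic n)) → Ω => h ⟨n, Finset.mem_Iic.2 le_rfl⟩)
          (measurable_pi_apply _)) :=
  chain_map_of_intertwining (indepMH q w) Khat μ₀ measurable_snd (crnPair_map_snd Fact.out hw0 Khat hK)

/-- **THE DIAGONAL START IS ONE RUN RECORDED TWICE**: the pair chain started from the diagonal lift of `μ` is the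
image of the run from `μ` under `x ↦ (n ↦ (x n, x n))`. [ours] -/
theorem crn_chain_diagLift [Fact (Measurable w)] (hw0 : ∀ y, 0 < w y) (Khat : Kernel (Ω × Ω) (Ω × Ω))
    [IsMarkovKernel Khat]
    (hK : ∀ z : Ω × Ω, Khat z = (q.prod (volume : Measure unitInterval)).map (fun p : Ω × unitInterval =>
      ((if (p.2 : ℝ) * w z.1 ≤ w p.1 then p.1 else z.1), (if (p.2 : ℝ) * w z.2 ≤ w p.1 then p.1 else z.2))))
    (μ : Measure Ω) [IsProbabilityMeasure μ] :
    Kernel.trajMeasure (X := fun _ : ℕ => Ω × Ω) (μ.map (fun y : Ω => (y, y)))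
        (fun n : ℕ => Khat.comap (fun h : (i : ↥(Finset.Iic n)) → Ω × Ω => h ⟨n, Finset.mem_Iic.2 le_rfl⟩)
          (measurable_pi_apply _)) =
      (Kernel.trajMeasure (X := fun _ : ℕ => Ω) μ
        (fun n : ℕ => (indepMH q w).comap (fun h : (i : ↥(Finset.Iic n)) → Ω => h ⟨n, Finset.mem_Iic.2 le_rfl⟩)
          (measurable_pi_apply _))).map (fun (x : ℕ → Ω) (n : ℕ) => (x n, x n)) :=
  (chain_map_of_intertwining Khat (indepMH q w) μ (measurable_id.prodMk measurable_id)
    (fun x => (crnPair_diag_apply Fact.out hw0 Khat hK x).symm)).symm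

/-! ## §2 The pair stream after `b` shared updates, from every initial coupling -/

/-- **THE PAIR PATH LAW AFTER `b` SHARED UPDATES, FROM EVERY INITIAL COUPLING.**  `w` measurable (a `Fact`), positive,
normalised, maximal at `x₀` with `w(x₀) > 1`; `r = 1 − 1/w(x₀)`; `K̂` a CRN pair kernel, `R̂` the residual kernel of
`K̂ ≥ (1/w(x₀))·π̂`.  For every probability law `μ̂₀` on `Ω × Ω`:
`P̂_{μ̂₀} ∘ θ_b⁻¹ = (1 − r^b)·(P_π ∘ (x ↦ (x, x))⁻¹) + r^b·P̂_{μ̂₀R̂^b}`. [ours] -/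
theorem crn_chain_shift_anyCoupling [Fact (Measurable w)] (hw0 : ∀ y, 0 < w y) {x₀ : Ω} (hmax : ∀ y, w y ≤ w x₀)
    (hlt : 1 < w x₀) [IsProbabilityMeasure (q.withDensity fun y => ENNReal.ofReal (w y))]
    (Khat : Kernel (Ω × Ω) (Ω × Ω)) [IsMarkovKernel Khat]
    (hK : ∀ z : Ω × Ω, Khat z = (q.prod (volume : Measure unitInterval)).map (fun p : Ω × unitInterval =>
      ((if (p.2 : ℝ) * w z.1 ≤ w p.1 then p.1 else z.1), (if (p.2 : ℝ) * w z.2 ≤ w p.1 then p.1 else z.2))))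
    (μ₀ : Measure (Ω × Ω)) [IsProbabilityMeasure μ₀] (b : ℕ) :
    (Kernel.trajMeasure (X := fun _ : ℕ => Ω × Ω) μ₀
        (fun n : ℕ => Khat.comap (fun h : (i : ↥(Finset.Iic n)) → Ω × Ω => h ⟨n, Finset.mem_Iic.2 le_rfl⟩)
          (measurable_pi_apply _))).map (fun (z : ℕ → Ω × Ω) (n : ℕ) => z (b + n)) =
      ENNReal.ofReal (1 - (1 - (w x₀)⁻¹) ^ b) •
          (Kernel.trajMeasure (X := fun _ : ℕ => Ω) (q.withDensity fun y => ENNReal.ofReal (w y))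
            (fun n : ℕ => (indepMH q w).comap (fun h : (i : ↥(Finset.Iic n)) → Ω => h ⟨n, Finset.mem_Iic.2 le_rfl⟩)
              (measurable_pi_apply _))).map (fun (x : ℕ → Ω) (n : ℕ) => (x n, x n)) +
        ENNReal.ofReal ((1 - (w x₀)⁻¹) ^ b) •
          Kernel.trajMeasure (X := fun _ : ℕ => Ω × Ω)
            ((fun m : Measure (Ω × Ω) => m.bind
              (@Doeblin.residualKernel (Ω × Ω) _ Khat _ ((q.withDensity fun y => ENNReal.ofReal (w y)).map
                (fun y : Ω => (y, y))) (isProbabilityMeasure_diagLift _) (ENNReal.ofReal (w x₀)⁻¹)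
                (crnPair_minorised Fact.out hw0 hmax Khat hK)))^[b] μ₀)
            (fun n : ℕ => Khat.comap (fun h : (i : ↥(Finset.Iic n)) → Ω × Ω => h ⟨n, Finset.mem_Iic.2 le_rfl⟩)
              (measurable_pi_apply _)) := by
  rw [chain_map_shift_eq Khat μ₀ b, iterate_bind_crnPair_eq_residual_mixture Fact.out hw0 hmax hlt Khat hK b μ₀,
    chain_add_smul, crn_chain_diagLift hw0 Khat hK]

/-- **`R̂`-free form, every `w(x₀) ≥ 1`**: `P̂_{μ̂₀} ∘ θ_b⁻¹ = (1 − r^b)·(P_π ∘ (x ↦ (x, x))⁻¹) + r^b·P̂_{ν̂}` for some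
probability law `ν̂` on `Ω × Ω`. [ours] -/
theorem crn_chain_shift_anyCoupling_exists [Fact (Measurable w)] (hw0 : ∀ y, 0 < w y) {x₀ : Ω}
    (hmax : ∀ y, w y ≤ w x₀) [IsProbabilityMeasure (q.withDensity fun y => ENNReal.ofReal (w y))]
    (Khat : Kernel (Ω × Ω) (Ω × Ω)) [IsMarkovKernel Khat]
    (hK : ∀ z : Ω × Ω, Khat z = (q.prod (volume : Measure unitInterval)).map (fun p : Ω × unitInterval =>
      ((if (p.2 : ℝ) * w z.1 ≤ w p.1 then p.1 else z.1), (if (p.2 : ℝ) * w z.2 ≤ w p.1 then p.1 else z.2))))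
    (μ₀ : Measure (Ω × Ω)) [IsProbabilityMeasure μ₀] (b : ℕ) :
    ∃ ν : Measure (Ω × Ω), IsProbabilityMeasure ν ∧
      (Kernel.trajMeasure (X := fun _ : ℕ => Ω × Ω) μ₀
          (fun n : ℕ => Khat.comap (fun h : (i : ↥(Finset.Iic n)) → Ω × Ω => h ⟨n, Finset.mem_Iic.2 le_rfl⟩)
            (measurable_pi_apply _))).map (fun (z : ℕ → Ω × Ω) (n : ℕ) => z (b + n)) =
        ENNReal.ofReal (1 - (1 - (w x₀)⁻¹) ^ b) •
            (Kernel.trajMeasure (X := fun _ : ℕ => Ω) (q.withDensity fun y => ENNReal.ofReal (w y))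
              (fun n : ℕ => (indepMH q w).comap (fun h : (i : ↥(Finset.Iic n)) → Ω => h ⟨n, Finset.mem_Iic.2 le_rfl⟩)
                (measurable_pi_apply _))).map (fun (x : ℕ → Ω) (n : ℕ) => (x n, x n)) +
          ENNReal.ofReal ((1 - (w x₀)⁻¹) ^ b) •
            Kernel.trajMeasure (X := fun _ : ℕ => Ω × Ω) ν
              (fun n : ℕ => Khat.comap (fun h : (i : ↥(Finset.Iic n)) → Ω × Ω => h ⟨n, Finset.mem_Iic.2 le_rfl⟩)
                (measurable_pi_apply _)) := by
  obtain ⟨ν, hν, h⟩ := exists_iterate_bind_crnPair_eq_mixture (q := q) Fact.out hw0 hmax Khat hK b μ₀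
  refine ⟨ν, hν, ?_⟩
  rw [chain_map_shift_eq Khat μ₀ b, h, chain_add_smul, crn_chain_diagLift hw0 Khat hK]

/-! ## §3 Every path statistic, every initial coupling -/

/-- **THE LOWER ENVELOPE ON PAIR STREAMS**: for every measurable set `S` of pair streams and every initial coupling,
`P̂_{μ̂₀}(Ẑ_{b+·} ∈ S) ≥ (1 − r^b)·P_π{x : (n ↦ (x n, x n)) ∈ S}`. [ours] -/
theorem crn_chain_shift_real_ge [Fact (Measurable w)] (hw0 : ∀ y, 0 < w y) {x₀ : Ω} (hmax : ∀ y, w y ≤ w x₀)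
    [IsProbabilityMeasure (q.withDensity fun y => ENNReal.ofReal (w y))]
    (Khat : Kernel (Ω × Ω) (Ω × Ω)) [IsMarkovKernel Khat]
    (hK : ∀ z : Ω × Ω, Khat z = (q.prod (volume : Measure unitInterval)).map (fun p : Ω × unitInterval =>
      ((if (p.2 : ℝ) * w z.1 ≤ w p.1 then p.1 else z.1), (if (p.2 : ℝ) * w z.2 ≤ w p.1 then p.1 else z.2))))
    (μ₀ : Measure (Ω × Ω)) [IsProbabilityMeasure μ₀] (b : ℕ) {S : Set (ℕ → Ω × Ω)} (hS : MeasurableSet S) :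
    (1 - (1 - (w x₀)⁻¹) ^ b) *
        (Kernel.trajMeasure (X := fun _ : ℕ => Ω) (q.withDensity fun y => ENNReal.ofReal (w y))
          (fun n : ℕ => (indepMH q w).comap (fun h : (i : ↥(Finset.Iic n)) → Ω => h ⟨n, Finset.mem_Iic.2 le_rfl⟩)
            (measurable_pi_apply _))).real {x | (fun n => (x n, x n)) ∈ S} ≤
      (Kernel.trajMeasure (X := fun _ : ℕ => Ω × Ω) μ₀
        (fun n : ℕ => Khat.comap (fun h : (i : ↥(Finset.Iic n)) → Ω × Ω => h ⟨n, Finset.mem_Iic.2 le_rfl⟩)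
          (measurable_pi_apply _))).real {z | (fun n => z (b + n)) ∈ S} := by
  obtain ⟨ν, hν, h⟩ := crn_chain_shift_anyCoupling_exists hw0 hmax Khat hK μ₀ b
  have hΘ : Measurable (fun (z : ℕ → Ω × Ω) (n : ℕ) => z (b + n)) :=
    measurable_pi_lambda _ fun n => measurable_pi_apply _
  have hD : Measurable (fun (x : ℕ → Ω) (n : ℕ) => (x n, x n)) :=
    measurable_pi_lambda _ fun n => (measurable_pi_apply n).prodMk (measurable_pi_apply n)
  have hW : 1 ≤ w x₀ := one_le_of_mode (q := q) hmax
  have hr0 : 0 ≤ 1 - (w x₀)⁻¹ := sub_nonneg.2 (inv_le_one_of_one_le₀ hW)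
  have hr1 : 1 - (w x₀)⁻¹ ≤ 1 := sub_le_self _ (inv_nonneg.mpr (hw0 x₀).le)
  have hc0 : 0 ≤ 1 - (1 - (w x₀)⁻¹) ^ b := sub_nonneg.2 (pow_le_one₀ hr0 hr1)
  have hpre := map_measureReal_apply hΘ hS (μ := Kernel.trajMeasure (X := fun _ : ℕ => Ω × Ω) μ₀
        (fun n : ℕ => Khat.comap (fun h : (i : ↥(Finset.Iic n)) → Ω × Ω => h ⟨n, Finset.mem_Iic.2 le_rfl⟩)
          (measurable_pi_apply _)))
  rw [show (fun (z : ℕ → Ω × Ω) (n : ℕ) => z (b + n)) ⁻¹' S = {z | (fun n => z (b + n)) ∈ S} from rfl] at hpre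
  rw [← hpre, h]
  simp only [measureReal_def, Measure.add_apply, Measure.smul_apply, smul_eq_mul, Measure.map_apply hD hS]
  rw [ENNReal.toReal_add (ENNReal.mul_ne_top ENNReal.ofReal_ne_top (measure_ne_top _ _))
      (ENNReal.mul_ne_top ENNReal.ofReal_ne_top (measure_ne_top _ _)), ENNReal.toReal_mul,
    ENNReal.toReal_ofReal hc0]
  exact le_add_of_nonneg_right ENNReal.toReal_nonneg

/-- **THE TWO RECORDED STREAMS RETURN IDENTICAL RESULTS** (diagonal-free, any measurable space): for every
measurable path statistic `F` and every initial coupling, `P(F(X_{b+·}) = F(X′_{b+·})) ≥ 1 − r^b`. [ours] -/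
theorem crn_chain_statistic_eq_ge [Fact (Measurable w)] (hw0 : ∀ y, 0 < w y) {x₀ : Ω} (hmax : ∀ y, w y ≤ w x₀)
    [IsProbabilityMeasure (q.withDensity fun y => ENNReal.ofReal (w y))]
    (Khat : Kernel (Ω × Ω) (Ω × Ω)) [IsMarkovKernel Khat]
    (hK : ∀ z : Ω × Ω, Khat z = (q.prod (volume : Measure unitInterval)).map (fun p : Ω × unitInterval =>
      ((if (p.2 : ℝ) * w z.1 ≤ w p.1 then p.1 else z.1), (if (p.2 : ℝ) * w z.2 ≤ w p.1 then p.1 else z.2))))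
    (μ₀ : Measure (Ω × Ω)) [IsProbabilityMeasure μ₀] (b : ℕ) {F : (ℕ → Ω) → ℝ} (hF : Measurable F) :
    1 - (1 - (w x₀)⁻¹) ^ b ≤
      (Kernel.trajMeasure (X := fun _ : ℕ => Ω × Ω) μ₀
        (fun n : ℕ => Khat.comap (fun h : (i : ↥(Finset.Iic n)) → Ω × Ω => h ⟨n, Finset.mem_Iic.2 le_rfl⟩)
          (measurable_pi_apply _))).real
        {z | F (fun n => (z (b + n)).1) = F (fun n => (z (b + n)).2)} := by
  have h1 : Measurable (fun (z : ℕ → Ω × Ω) => F (fun n => (z n).1)) :=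
    hF.comp (measurable_pi_lambda _ fun n => measurable_fst.comp (measurable_pi_apply n))
  have h2 : Measurable (fun (z : ℕ → Ω × Ω) => F (fun n => (z n).2)) :=
    hF.comp (measurable_pi_lambda _ fun n => measurable_snd.comp (measurable_pi_apply n))
  have hS : MeasurableSet {z : ℕ → Ω × Ω | F (fun n => (z n).1) = F (fun n => (z n).2)} :=
    measurableSet_eq_fun h1 h2
  have h := crn_chain_shift_real_ge hw0 hmax Khat hK μ₀ b hS
  have hset : {x : ℕ → Ω | (fun n => (x n, x n)) ∈
      {z : ℕ → Ω × Ω | F (fun n => (z n).1) = F (fun n => (z n).2)}} = univ := by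
    ext x; simp
  rw [hset, probReal_univ, mul_one] at h
  exact h

/-- **THE RUNS COINCIDE FOREVER AFTER THE BURN-IN** (`MeasurableEq Ω` — every Polish configuration space):
`P(X_{b+n} = X′_{b+n} for every n) ≥ 1 − r^b`, from every initial coupling. [ours] -/
theorem crn_chain_coincide_forever_ge [Fact (Measurable w)] (hw0 : ∀ y, 0 < w y) {x₀ : Ω}
    (hmax : ∀ y, w y ≤ w x₀) [IsProbabilityMeasure (q.withDensity fun y => ENNReal.ofReal (w y))]
    [MeasurableEq Ω]
    (Khat : Kernel (Ω × Ω) (Ω × Ω)) [IsMarkovKernel Khat]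
    (hK : ∀ z : Ω × Ω, Khat z = (q.prod (volume : Measure unitInterval)).map (fun p : Ω × unitInterval =>
      ((if (p.2 : ℝ) * w z.1 ≤ w p.1 then p.1 else z.1), (if (p.2 : ℝ) * w z.2 ≤ w p.1 then p.1 else z.2))))
    (μ₀ : Measure (Ω × Ω)) [IsProbabilityMeasure μ₀] (b : ℕ) :
    1 - (1 - (w x₀)⁻¹) ^ b ≤
      (Kernel.trajMeasure (X := fun _ : ℕ => Ω × Ω) μ₀
        (fun n : ℕ => Khat.comap (fun h : (i : ↥(Finset.Iic n)) → Ω × Ω => h ⟨n, Finset.mem_Iic.2 le_rfl⟩)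
          (measurable_pi_apply _))).real {z | ∀ n, z (b + n) ∈ Set.diagonal Ω} := by
  have hS : MeasurableSet {z : ℕ → Ω × Ω | ∀ n, z n ∈ Set.diagonal Ω} := by
    have : {z : ℕ → Ω × Ω | ∀ n, z n ∈ Set.diagonal Ω} = ⋂ n, (fun z : ℕ → Ω × Ω => z n) ⁻¹' Set.diagonal Ω := by
      ext z; simp
    rw [this]
    exact MeasurableSet.iInter fun n => (measurable_pi_apply n) measurableSet_diagonal
  have h := crn_chain_shift_real_ge hw0 hmax Khat hK μ₀ b hS
  have hset : {x : ℕ → Ω | (fun n => (x n, x n)) ∈ {z : ℕ → Ω × Ω | ∀ n, z n ∈ Set.diagonal Ω}} = univ := by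
    ext x; simp [Set.mem_diagonal_iff]
  rw [hset, probReal_univ, mul_one] at h
  exact h

/-- **`log(1/δ) ≤ b·A` SHARED UPDATES MAKE THE TWO RUNS COINCIDE FOREVER WITH PROBABILITY `≥ 1 − δ`** (`MeasurableEq Ω`). [ours] -/
theorem crn_chain_coincide_forever_ge_of_log_le [Fact (Measurable w)] (hw0 : ∀ y, 0 < w y) {x₀ : Ω}
    (hmax : ∀ y, w y ≤ w x₀) [IsProbabilityMeasure (q.withDensity fun y => ENNReal.ofReal (w y))]
    [MeasurableEq Ω]
    (Khat : Kernel (Ω × Ω) (Ω × Ω)) [IsMarkovKernel Khat]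
    (hK : ∀ z : Ω × Ω, Khat z = (q.prod (volume : Measure unitInterval)).map (fun p : Ω × unitInterval =>
      ((if (p.2 : ℝ) * w z.1 ≤ w p.1 then p.1 else z.1), (if (p.2 : ℝ) * w z.2 ≤ w p.1 then p.1 else z.2))))
    (μ₀ : Measure (Ω × Ω)) [IsProbabilityMeasure μ₀] (b : ℕ) {δ : ℝ} (hδ : 0 < δ)
    (hb : Real.log (1 / δ) ≤ b * (w x₀)⁻¹) :
    1 - δ ≤
      (Kernel.trajMeasure (X := fun _ : ℕ => Ω × Ω) μ₀
        (fun n : ℕ => Khat.comap (fun h : (i : ↥(Finset.Iic n)) → Ω × Ω => h ⟨n, Finset.mem_Iic.2 le_rfl⟩)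
          (measurable_pi_apply _))).real {z | ∀ n, z (b + n) ∈ Set.diagonal Ω} := by
  have h := crn_chain_coincide_forever_ge hw0 hmax Khat hK μ₀ b
  have hW : 1 ≤ w x₀ := one_le_of_mode (q := q) hmax
  have hr0 : 0 ≤ 1 - (w x₀)⁻¹ := sub_nonneg.2 (inv_le_one_of_one_le₀ hW)
  have hrb : (1 - (w x₀)⁻¹) ^ b ≤ δ := by
    calc (1 - (w x₀)⁻¹) ^ b ≤ Real.exp (-(w x₀)⁻¹) ^ b := by
          gcongr
          have := Real.add_one_le_exp (-(w x₀)⁻¹)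
          linarith
      _ = Real.exp (-(b * (w x₀)⁻¹)) := by rw [← Real.exp_nat_mul]; ring_nf
      _ ≤ Real.exp (-Real.log (1 / δ)) := Real.exp_le_exp.2 (neg_le_neg hb)
      _ = δ := by rw [Real.exp_neg, Real.exp_log (by positivity), one_div, inv_inv]
  linarith

/-- **THE COMMON-RANDOM-NUMBERS DIFFERENCE OF EVERY BOUNDED STATISTIC IS AT MOST `r^b ×` ITS RANGE, IN MEAN**: for a
measurable path statistic `a ≤ F ≤ c` and every initial coupling, `E|F(X_{b+·}) − F(X′_{b+·})| ≤ r^b·(c − a)`.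
[ours] -/
theorem crn_chain_integral_abs_sub_le [Fact (Measurable w)] (hw0 : ∀ y, 0 < w y) {x₀ : Ω}
    (hmax : ∀ y, w y ≤ w x₀) [IsProbabilityMeasure (q.withDensity fun y => ENNReal.ofReal (w y))]
    (Khat : Kernel (Ω × Ω) (Ω × Ω)) [IsMarkovKernel Khat]
    (hK : ∀ z : Ω × Ω, Khat z = (q.prod (volume : Measure unitInterval)).map (fun p : Ω × unitInterval =>
      ((if (p.2 : ℝ) * w z.1 ≤ w p.1 then p.1 else z.1), (if (p.2 : ℝ) * w z.2 ≤ w p.1 then p.1 else z.2))))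
    (μ₀ : Measure (Ω × Ω)) [IsProbabilityMeasure μ₀] (b : ℕ) {F : (ℕ → Ω) → ℝ} (hF : Measurable F) {a c : ℝ}
    (ha : ∀ x, a ≤ F x) (hc : ∀ x, F x ≤ c) :
    ∫ z, |F (fun n => (z (b + n)).1) - F (fun n => (z (b + n)).2)|
        ∂(Kernel.trajMeasure (X := fun _ : ℕ => Ω × Ω) μ₀
          (fun n : ℕ => Khat.comap (fun h : (i : ↥(Finset.Iic n)) → Ω × Ω => h ⟨n, Finset.mem_Iic.2 le_rfl⟩)
            (measurable_pi_apply _))) ≤ (1 - (w x₀)⁻¹) ^ b * (c - a) := by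
  obtain ⟨ν, hν, h⟩ := crn_chain_shift_anyCoupling_exists hw0 hmax Khat hK μ₀ b
  have hΘ : Measurable (fun (z : ℕ → Ω × Ω) (n : ℕ) => z (b + n)) :=
    measurable_pi_lambda _ fun n => measurable_pi_apply _
  have hD : Measurable (fun (x : ℕ → Ω) (n : ℕ) => (x n, x n)) :=
    measurable_pi_lambda _ fun n => (measurable_pi_apply n).prodMk (measurable_pi_apply n)
  have hW : 1 ≤ w x₀ := one_le_of_mode (q := q) hmax
  have hr0 : 0 ≤ 1 - (w x₀)⁻¹ := sub_nonneg.2 (inv_le_one_of_one_le₀ hW)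
  have hr1 : 1 - (w x₀)⁻¹ ≤ 1 := sub_le_self _ (inv_nonneg.mpr (hw0 x₀).le)
  have hc0 : 0 ≤ 1 - (1 - (w x₀)⁻¹) ^ b := sub_nonneg.2 (pow_le_one₀ hr0 hr1)
  -- the statistic `G(z) = |F(z₁) − F(z₂)|` on pair streams
  have hGm : Measurable (fun z : ℕ → Ω × Ω => |F (fun n => (z n).1) - F (fun n => (z n).2)|) :=
    ((hF.comp (measurable_pi_lambda _ fun n => measurable_fst.comp (measurable_pi_apply n))).sub
      (hF.comp (measurable_pi_lambda _ fun n => measurable_snd.comp (measurable_pi_apply n)))).abs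
  have hGb : ∀ z : ℕ → Ω × Ω, |(fun z : ℕ → Ω × Ω => |F (fun n => (z n).1) - F (fun n => (z n).2)|) z| ≤
      max |(0 : ℝ)| |c - a| := by
    intro z
    dsimp only
    have h1 := ha (fun n => (z n).1); have h2 := hc (fun n => (z n).1)
    have h3 := ha (fun n => (z n).2); have h4 := hc (fun n => (z n).2)
    exact abs_le_max_abs_abs (abs_nonneg _) (abs_le.2 ⟨by linarith, by linarith⟩)
  have hGi : ∀ (m : Measure (ℕ → Ω × Ω)) [IsFiniteMeasure m],
      Integrable (fun z : ℕ → Ω × Ω => |F (fun n => (z n).1) - F (fun n => (z n).2)|) m :=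
    fun m _ => integrable_of_bounded m hGm hGb
  -- rewrite through the shift and the split
  have hmap : ∫ z, |F (fun n => (z (b + n)).1) - F (fun n => (z (b + n)).2)|
        ∂(Kernel.trajMeasure (X := fun _ : ℕ => Ω × Ω) μ₀
          (fun n : ℕ => Khat.comap (fun h : (i : ↥(Finset.Iic n)) → Ω × Ω => h ⟨n, Finset.mem_Iic.2 le_rfl⟩)
            (measurable_pi_apply _))) =
      ∫ z, |F (fun n => (z n).1) - F (fun n => (z n).2)|
        ∂((Kernel.trajMeasure (X := fun _ : ℕ => Ω × Ω) μ₀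
          (fun n : ℕ => Khat.comap (fun h : (i : ↥(Finset.Iic n)) → Ω × Ω => h ⟨n, Finset.mem_Iic.2 le_rfl⟩)
            (measurable_pi_apply _))).map (fun (z : ℕ → Ω × Ω) (n : ℕ) => z (b + n))) :=
    (integral_map hΘ.aemeasurable hGm.aestronglyMeasurable).symm
  rw [hmap, h]
  haveI : IsProbabilityMeasure (Kernel.trajMeasure (X := fun _ : ℕ => Ω × Ω) ν
      (fun n : ℕ => Khat.comap (fun h : (i : ↥(Finset.Iic n)) → Ω × Ω => h ⟨n, Finset.mem_Iic.2 le_rfl⟩)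
        (measurable_pi_apply _))) := by infer_instance
  rw [integral_add_measure ((hGi _).smul_measure ENNReal.ofReal_ne_top) ((hGi _).smul_measure ENNReal.ofReal_ne_top),
    integral_smul_measure, integral_smul_measure, ENNReal.toReal_ofReal hc0, ENNReal.toReal_ofReal (pow_nonneg hr0 b),
    smul_eq_mul, smul_eq_mul, integral_map hD.aemeasurable hGm.aestronglyMeasurable]
  simp only [sub_self, abs_zero, integral_zero, mul_zero, zero_add]
  have hνb : ∫ z, |F (fun n => (z n).1) - F (fun n => (z n).2)| ∂(Kernel.trajMeasure (X := fun _ : ℕ => Ω × Ω) ν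
      (fun n : ℕ => Khat.comap (fun h : (i : ↥(Finset.Iic n)) → Ω × Ω => h ⟨n, Finset.mem_Iic.2 le_rfl⟩)
        (measurable_pi_apply _))) ≤ c - a := by
    have := integral_mono (hGi (Kernel.trajMeasure (X := fun _ : ℕ => Ω × Ω) ν
      (fun n : ℕ => Khat.comap (fun h : (i : ↥(Finset.Iic n)) → Ω × Ω => h ⟨n, Finset.mem_Iic.2 le_rfl⟩)
        (measurable_pi_apply _)))) (integrable_const (c - a)) (fun z => by
      have h1 := ha (fun n => (z n).1); have h2 := hc (fun n => (z n).1)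
      have h3 := ha (fun n => (z n).2); have h4 := hc (fun n => (z n).2)
      exact abs_le.2 ⟨by linarith, by linarith⟩)
    rwa [integral_const, probReal_univ, one_smul] at this
  exact mul_le_mul_of_nonneg_left hνb (pow_nonneg hr0 b)

/-- **THE CRN DIFFERENCE ESTIMATOR HAS SECOND MOMENT AT MOST `r^b·(c − a)²`**: for a measurable path statistic
`a ≤ F ≤ c` and every initial coupling, `E[(F(X_{b+·}) − F(X′_{b+·}))²] ≤ r^b·(c − a)²` — estimating the
difference of two starts' expectations (GEN-35: at most `r^b·(c − a)`) by ONE coupled pair has root-mean-square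
error at most `r^{b/2}·(c − a)`, against `≍ (c − a)` for two independent runs. [ours] -/
theorem crn_chain_integral_sq_sub_le [Fact (Measurable w)] (hw0 : ∀ y, 0 < w y) {x₀ : Ω}
    (hmax : ∀ y, w y ≤ w x₀) [IsProbabilityMeasure (q.withDensity fun y => ENNReal.ofReal (w y))]
    (Khat : Kernel (Ω × Ω) (Ω × Ω)) [IsMarkovKernel Khat]
    (hK : ∀ z : Ω × Ω, Khat z = (q.prod (volume : Measure unitInterval)).map (fun p : Ω × unitInterval =>
      ((if (p.2 : ℝ) * w z.1 ≤ w p.1 then p.1 else z.1), (if (p.2 : ℝ) * w z.2 ≤ w p.1 then p.1 else z.2))))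
    (μ₀ : Measure (Ω × Ω)) [IsProbabilityMeasure μ₀] (b : ℕ) {F : (ℕ → Ω) → ℝ} (hF : Measurable F) {a c : ℝ}
    (ha : ∀ x, a ≤ F x) (hc : ∀ x, F x ≤ c) :
    ∫ z, (F (fun n => (z (b + n)).1) - F (fun n => (z (b + n)).2)) ^ 2
        ∂(Kernel.trajMeasure (X := fun _ : ℕ => Ω × Ω) μ₀
          (fun n : ℕ => Khat.comap (fun h : (i : ↥(Finset.Iic n)) → Ω × Ω => h ⟨n, Finset.mem_Iic.2 le_rfl⟩)
            (measurable_pi_apply _))) ≤ (1 - (w x₀)⁻¹) ^ b * (c - a) ^ 2 := by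
  set P : Measure (ℕ → Ω × Ω) := Kernel.trajMeasure (X := fun _ : ℕ => Ω × Ω) μ₀
      (fun n : ℕ => Khat.comap (fun h : (i : ↥(Finset.Iic n)) → Ω × Ω => h ⟨n, Finset.mem_Iic.2 le_rfl⟩)
        (measurable_pi_apply _)) with hP
  have habs := crn_chain_integral_abs_sub_le hw0 hmax Khat hK μ₀ b hF ha hc
  have hW : 1 ≤ w x₀ := one_le_of_mode (q := q) hmax
  have hr0 : 0 ≤ 1 - (w x₀)⁻¹ := sub_nonneg.2 (inv_le_one_of_one_le₀ hW)
  have hca : 0 ≤ c - a := by have h1 := ha (fun _ => x₀); have h2 := hc (fun _ => x₀); linarith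
  have h1m : Measurable (fun z : ℕ → Ω × Ω => F (fun n => (z (b + n)).1)) :=
    hF.comp (measurable_pi_lambda _ fun n => measurable_fst.comp (measurable_pi_apply (b + n)))
  have h2m : Measurable (fun z : ℕ → Ω × Ω => F (fun n => (z (b + n)).2)) :=
    hF.comp (measurable_pi_lambda _ fun n => measurable_snd.comp (measurable_pi_apply (b + n)))
  have hDm : Measurable (fun z : ℕ → Ω × Ω => |F (fun n => (z (b + n)).1) - F (fun n => (z (b + n)).2)|) :=
    (h1m.sub h2m).abs
  have hbd : ∀ z : ℕ → Ω × Ω, |F (fun n => (z (b + n)).1) - F (fun n => (z (b + n)).2)| ≤ c - a := by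
    intro z
    have h1 := ha (fun n => (z (b + n)).1); have h2 := hc (fun n => (z (b + n)).1)
    have h3 := ha (fun n => (z (b + n)).2); have h4 := hc (fun n => (z (b + n)).2)
    exact abs_le.2 ⟨by linarith, by linarith⟩
  have hDi : Integrable (fun z : ℕ → Ω × Ω => |F (fun n => (z (b + n)).1) - F (fun n => (z (b + n)).2)|) P :=
    integrable_of_bounded P hDm (C := c - a) (fun z => by simpa only [abs_abs] using hbd z)
  -- `(F − F′)² ≤ (c − a)·|F − F′|` pointwise
  have hpt : ∀ z : ℕ → Ω × Ω, (F (fun n => (z (b + n)).1) - F (fun n => (z (b + n)).2)) ^ 2 ≤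
      (c - a) * |F (fun n => (z (b + n)).1) - F (fun n => (z (b + n)).2)| := by
    intro z
    rw [← sq_abs]
    rw [sq]
    exact mul_le_mul_of_nonneg_right (hbd z) (abs_nonneg _)
  have hSm : Measurable (fun z : ℕ → Ω × Ω => (F (fun n => (z (b + n)).1) - F (fun n => (z (b + n)).2)) ^ 2) :=
    (h1m.sub h2m).pow_const 2
  have hSi : Integrable (fun z : ℕ → Ω × Ω => (F (fun n => (z (b + n)).1) - F (fun n => (z (b + n)).2)) ^ 2) P :=
    integrable_of_bounded P hSm (C := (c - a) ^ 2) (fun z => by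
      simpa only [abs_pow] using pow_le_pow_left₀ (abs_nonneg _) (hbd z) 2)
  calc ∫ z, (F (fun n => (z (b + n)).1) - F (fun n => (z (b + n)).2)) ^ 2 ∂P
      ≤ ∫ z, (c - a) * |F (fun n => (z (b + n)).1) - F (fun n => (z (b + n)).2)| ∂P :=
        integral_mono hSi (hDi.const_mul _) hpt
    _ = (c - a) * ∫ z, |F (fun n => (z (b + n)).1) - F (fun n => (z (b + n)).2)| ∂P := integral_const_mul _ _
    _ ≤ (c - a) * ((1 - (w x₀)⁻¹) ^ b * (c - a)) := mul_le_mul_of_nonneg_left habs hca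
    _ = (1 - (w x₀)⁻¹) ^ b * (c - a) ^ 2 := by ring

end Summit.Ventures.LatticeQCDFlow.Exactness

end
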